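import Summits.NavierStokesRegularity.NavierStokesRegularity.Theorems.PoloidalWindowRigidity.Negative.StrainedCrossedLayers
import HarnessLib

/-!
# Strained crossed suction layers — part 4: the slices
# (gradient, poloidal vorticity, proportional shear of slope `Λ(t) = α²/(α²+σ²)`, non-degeneracy,
# and the TIME VARIATION of the slope; crux `PoloidalWindowRigidity`, K2, 19708)

Theorems/…/Negative proofs file (theorems only, no `Prop` facts), continuing `StrainedCrossedLayers.lean`.

For the exact classical Navier–Stokes flow `u = strainedField s a b c` (part 3) every time slice has:
`Du(t,y)h = Mh + Σ_j E_j(y)⟪k_j(t),h⟫a_j(t)` (`fderiv_strainedField`), vorticity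
`ω = G(α²+σ²)(cE₃, bE₂ − aE₁, 0)` (`curl_strainedField`; poloidal: `inner_curl_strainedField_single_two`),
the proportional-shear slope relation `∂₀u₂ = −Λω₁, ∂₁u₂ = Λω₀` with `Λ(t) = α²/(α²+σ²)` SPATIALLY CONSTANT
(`slope_strainedField`) and `∂₂u_h = μ(t)∇_h u₂`, `μ(t) = −σ²/α² = −s²e^{−6t}` (`shear_strainedField`,
`sq_σ_div_sq_α`); for `c ≠ 0 ≠ s` the window non-degeneracy of `stub_lrc` holds at EVERY point of space–time
(`nondegenerate_strainedField`) and its space–time non-constancy hypothesis holds on EVERY open set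
(`shear_ratio_not_locally_constant`) — although each slice is exactly a constant-slope proportional-shear
field: the slope moves in time only.  This is the (TV) stratum («Λ spatially constant, ∂ₜΛ ≠ 0») that the
slice-wise settled theory (`…ProportionalShear*`, constant `λ`) does not see.

WHAT THIS IS NOT: not a statement about Navier–Stokes regularity or blow-up; the flow is unbounded and not in
`𝔓(C)`; no registered item is refuted.  References (mechanism only): [cite: CraikCriminale1986] (exact wave solutions on linear flows);
[cite: Drazin2002, Ex. 8.27 p. 151] (asymptotic suction profile).
-/

noncomputable section

open Set Function Filter InnerProductSpace WithLp
open scoped ContDiff InnerProductSpace RealInnerProductSpace InnerProduct Topology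

-- the summit and its single sub-problem share the name (CONVENTIONS §1)
set_option linter.dupNamespace false

/-! ## Slices of the strained crossed layers: gradient, vorticity, slope, shear, time variation -/

namespace Summit.NavierStokesRegularity.NavierStokesRegularity.Theorems.PoloidalWindowRigidity.Negative.StrainedLayers

open Real Literature.Analysis.FluidPDE Literature.Analysis.FluidPDE.KelvinMode
open Summit.NavierStokesRegularity.NavierStokesRegularity.Theorems.PoloidalWindowRigidity.Negative.ExpTriad

/-- Local notation for physical space `ℝ³ = EuclideanSpace ℝ (Fin 3)`. -/
local notation "ℝ³" => EuclideanSpace ℝ (Fin 3)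
/-- Local notation for the standard basis vectors. -/
local notation "𝐞" j => EuclideanSpace.single (j : Fin 3) (1 : ℝ)

variable (s a b c : ℝ)

/-! ### §6 The three layers on a slice -/

/-- First layer `E₁ = e^{αx₀ + σx₂} = e^{⟪k₁, x⟫}`. [folklore] -/
def E₁ (s t : ℝ) (y : ℝ³) : ℝ := exp (α t * y 0 + σ s t * y 2)
/-- Second layer `E₂ = e^{−αx₀ + σx₂} = e^{⟪k₂, x⟫}`. [folklore] -/
def E₂ (s t : ℝ) (y : ℝ³) : ℝ := exp (-(α t * y 0) + σ s t * y 2)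
/-- Third layer `E₃ = e^{αx₁ − σx₂} = e^{⟪k₃, x⟫}`. [folklore] -/
def E₃ (s t : ℝ) (y : ℝ³) : ℝ := exp (α t * y 1 - σ s t * y 2)

/-- The layers are positive. [folklore] -/
theorem E₁_pos (t : ℝ) (y : ℝ³) : 0 < E₁ s t y := exp_pos _
/-- The layers are positive. [folklore] -/
theorem E₂_pos (t : ℝ) (y : ℝ³) : 0 < E₂ s t y := exp_pos _
/-- The layers are positive. [folklore] -/
theorem E₃_pos (t : ℝ) (y : ℝ³) : 0 < E₃ s t y := exp_pos _

/-- `⟪k₁, y⟫ = αy₀ + σy₂`. [folklore] -/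
@[simp] theorem inner_kv_zero (t : ℝ) (y : ℝ³) : ⟪kv s 0 t, y⟫ = α t * y 0 + σ s t * y 2 := by
  simp [PiLp.inner_apply, Fin.sum_univ_three]; ring
/-- `⟪k₂, y⟫ = −αy₀ + σy₂`. [folklore] -/
@[simp] theorem inner_kv_one (t : ℝ) (y : ℝ³) : ⟪kv s 1 t, y⟫ = -(α t * y 0) + σ s t * y 2 := by
  simp [PiLp.inner_apply, Fin.sum_univ_three]; ring
/-- `⟪k₃, y⟫ = αy₁ − σy₂`. [folklore] -/
@[simp] theorem inner_kv_two (t : ℝ) (y : ℝ³) : ⟪kv s 2 t, y⟫ = α t * y 1 - σ s t * y 2 := by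
  simp [PiLp.inner_apply, Fin.sum_univ_three]; ring

/-! ### §7 The velocity gradient of a slice -/

/-- The Jacobian `jac t y j i = ∂ⱼ uᵢ(t, y)` of the slice `u(t, ·)`. [folklore] -/
def jac (t : ℝ) (y : ℝ³) : Fin 3 → Fin 3 → ℝ :=
  ![![-1 - G s t * α t * σ s t * (a * E₁ s t y + b * E₂ s t y), 0,
      G s t * α t ^ 2 * (a * E₁ s t y - b * E₂ s t y)],
    ![0, -1 + c * G s t * α t * σ s t * E₃ s t y, c * G s t * α t ^ 2 * E₃ s t y],
    ![G s t * σ s t ^ 2 * (b * E₂ s t y - a * E₁ s t y), -(c * G s t * σ s t ^ 2 * E₃ s t y),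
      2 + G s t * α t * σ s t * (a * E₁ s t y + b * E₂ s t y - c * E₃ s t y)]]

/-- **The velocity gradient of a slice**: `Du(t,y)h = Mh + Σ_j E_j(y) ⟪k_j, h⟫ a_j`. [folklore] -/
theorem fderiv_strainedField (t : ℝ) (y h : ℝ³) : fderiv ℝ (strainedField s a b c t) y h =
    M h + ((E₁ s t y * ⟪kv s 0 t, h⟫) • av s a b c 0 t + (E₂ s t y * ⟪kv s 1 t, h⟫) • av s a b c 1 t +
      (E₃ s t y * ⟪kv s 2 t, h⟫) • av s a b c 2 t) := by
  rw [strainedField, fderiv_triad_apply, inner_kv_zero, inner_kv_one, inner_kv_two]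
  rfl

/-- **Partial derivatives of a slice**: `∂ⱼuᵢ = jac j i`. [folklore] -/
theorem fderiv_strainedField_single (t : ℝ) (y : ℝ³) (j i : Fin 3) :
    fderiv ℝ (strainedField s a b c t) y (𝐞 j) i = jac s a b c t y j i := by
  rw [fderiv_strainedField]
  fin_cases j <;> fin_cases i <;> simp [jac, E₁, E₂, E₃, EuclideanSpace.inner_single_right] <;> ring

/-! ### §8 The vorticity of a slice: poloidal, with proportional shear of slope `Λ(t)` -/

/-- The slice vorticity `ω(t, ·) = G(α² + σ²)·(c E₃, b E₂ − a E₁, 0)`. [folklore] -/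
def vort (t : ℝ) (y : ℝ³) : ℝ³ :=
  toLp 2 ![c * G s t * (α t ^ 2 + σ s t ^ 2) * E₃ s t y,
    G s t * (α t ^ 2 + σ s t ^ 2) * (b * E₂ s t y - a * E₁ s t y), 0]

/-- Component `ω₀`. [folklore] -/
@[simp] theorem vort_apply_zero (t : ℝ) (y : ℝ³) :
    vort s a b c t y 0 = c * G s t * (α t ^ 2 + σ s t ^ 2) * E₃ s t y := rfl
/-- Component `ω₁`. [folklore] -/
@[simp] theorem vort_apply_one (t : ℝ) (y : ℝ³) :
    vort s a b c t y 1 = G s t * (α t ^ 2 + σ s t ^ 2) * (b * E₂ s t y - a * E₁ s t y) := rfl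
/-- Component `ω₂ = 0`. [folklore] -/
@[simp] theorem vort_apply_two (t : ℝ) (y : ℝ³) : vort s a b c t y 2 = 0 := rfl

/-- **The vorticity of a slice.** [folklore] -/
theorem curl_strainedField (t : ℝ) (y : ℝ³) : curl (strainedField s a b c t) y = vort s a b c t y := by
  ext i
  fin_cases i <;> simp [curl, fderiv_strainedField_single, jac, vort] <;> ring

/-- `curl u(t) = ω(t)` as functions. [folklore] -/
theorem curl_strainedField_eq (t : ℝ) : curl (strainedField s a b c t) = vort s a b c t :=
  funext (curl_strainedField s a b c t)

/-- **Poloidal**: the vertical vorticity vanishes identically (hypothesis shape of `stub_lrc`). [folklore] -/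
theorem inner_curl_strainedField_single_two (t : ℝ) (y : ℝ³) :
    ⟪curl (strainedField s a b c t) y, EuclideanSpace.single 2 1⟫ = 0 := by
  rw [curl_strainedField, EuclideanSpace.inner_single_right]; simp

/-- **Proportional-shear slope relation** `∇_h u₂ = Λ(t) J ω_h` with the SPATIALLY CONSTANT slope
`Λ(t) = α²/(α² + σ²) ∈ (0, 1)`: `∂₀u₂ = −Λ ω₁`, `∂₁u₂ = Λ ω₀`. [folklore] -/
theorem slope_strainedField (t : ℝ) (y : ℝ³) :
    fderiv ℝ (strainedField s a b c t) y (EuclideanSpace.single 0 1) 2 =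
        -(α t ^ 2 / (α t ^ 2 + σ s t ^ 2) * curl (strainedField s a b c t) y 1) ∧
      fderiv ℝ (strainedField s a b c t) y (EuclideanSpace.single 1 1) 2 =
        α t ^ 2 / (α t ^ 2 + σ s t ^ 2) * curl (strainedField s a b c t) y 0 := by
  have hn : α t ^ 2 + σ s t ^ 2 ≠ 0 := (normSq_pos s t).ne'
  refine ⟨?_, ?_⟩
  · rw [fderiv_strainedField_single, curl_strainedField]; simp [jac]; field_simp; ring
  · rw [fderiv_strainedField_single, curl_strainedField]; simp [jac]; field_simp

/-- **Proportional vertical shear** `∂₂u_h = μ(t) ∇_h u₂` with `μ(t) = −σ²/α² = 1 − 1/Λ(t)`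
(the relation whose space–time constancy `stub_lrc` negates in its last hypothesis). [folklore] -/
theorem shear_strainedField (t : ℝ) (y : ℝ³) (i : Fin 3) (hi : i ≠ 2) :
    fderiv ℝ (strainedField s a b c t) y (EuclideanSpace.single 2 1) i =
      -(σ s t ^ 2 / α t ^ 2) * fderiv ℝ (strainedField s a b c t) y (EuclideanSpace.single i 1) 2 := by
  have hα : α t ≠ 0 := α_ne_zero t
  rw [fderiv_strainedField_single, fderiv_strainedField_single]
  fin_cases i
  · simp [jac]; field_simp; ring
  · simp [jac]; field_simp
  · exact absurd rfl hi

/-- **Non-degeneracy everywhere** (for `c ≠ 0`, `s ≠ 0`): `ω ≠ 0`, `∇_h u₂ ≠ 0`, `∂₂u_h ≠ 0` at every point of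
every slice — the window hypothesis of `stub_lrc` holds on all of `ℝ × ℝ³`. [folklore] -/
theorem nondegenerate_strainedField (hc : c ≠ 0) (hs : s ≠ 0) (t : ℝ) (y : ℝ³) :
    curl (strainedField s a b c t) y ≠ 0 ∧
      (fderiv ℝ (strainedField s a b c t) y (EuclideanSpace.single 0 1) 2 ≠ 0 ∨
        fderiv ℝ (strainedField s a b c t) y (EuclideanSpace.single 1 1) 2 ≠ 0) ∧
      (fderiv ℝ (strainedField s a b c t) y (EuclideanSpace.single 2 1) 0 ≠ 0 ∨
        fderiv ℝ (strainedField s a b c t) y (EuclideanSpace.single 2 1) 1 ≠ 0) := by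
  have hG : G s t ≠ 0 := (G_pos s t).ne'
  have hα : α t ≠ 0 := α_ne_zero t
  have hσ : σ s t ≠ 0 := σ_ne_zero hs t
  have hE : E₃ s t y ≠ 0 := (E₃_pos s t y).ne'
  have hn : α t ^ 2 + σ s t ^ 2 ≠ 0 := (normSq_pos s t).ne'
  refine ⟨fun h => ?_, Or.inr ?_, Or.inr ?_⟩
  · have h0 := congrArg (fun v : ℝ³ => v 0) h
    simp only [curl_strainedField, vort_apply_zero, PiLp.zero_apply] at h0
    exact (mul_ne_zero (mul_ne_zero (mul_ne_zero hc hG) hn) hE) h0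
  · rw [fderiv_strainedField_single]; simp [jac, hc, hG, hα, hE]
  · rw [fderiv_strainedField_single]; simp [jac, hc, hG, hσ, hE]

/-! ### §9 The slope varies in time: the space–time non-constancy hypothesis of `stub_lrc` holds -/

/-- `σ²/α² = s² e^{−6t}` is injective in `t` (for `s ≠ 0`): the key to the time variation. [folklore] -/
theorem sq_σ_div_sq_α (t : ℝ) : σ s t ^ 2 / α t ^ 2 = s ^ 2 * exp (-6 * t) := by
  have h1 : α t ^ 2 = exp (2 * t) := by rw [α, ← exp_nat_mul]; norm_num
  have h2 : σ s t ^ 2 = s ^ 2 * exp (-4 * t) := by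
    rw [σ, mul_pow, ← exp_nat_mul]; ring_nf
  rw [h1, h2, mul_div_assoc, ← exp_sub]; ring_nf

/-- **Space–time non-constancy of the shear ratio** (the last hypothesis of `stub_lrc`, on EVERY open
space–time set, for `c ≠ 0`, `s ≠ 0`): no constant `μ` satisfies `∂₂u₁ = μ ∂₁u₂` throughout an open
`W₁ ⊆ ℝ × ℝ³`, because `∂₂u₁/∂₁u₂ = −s²e^{−6t}` is strictly monotone in `t`. [folklore] -/
theorem shear_ratio_not_locally_constant (hc : c ≠ 0) (hs : s ≠ 0) (μ : ℝ)
    (W₁ : Set (ℝ × ℝ³)) (hW : IsOpen W₁) (hne : W₁.Nonempty) :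
    ∃ z ∈ W₁, ∃ i : Fin 3, i ≠ 2 ∧
      fderiv ℝ (strainedField s a b c z.1) z.2 (EuclideanSpace.single 2 1) i ≠
        μ * fderiv ℝ (strainedField s a b c z.1) z.2 (EuclideanSpace.single i 1) 2 := by
  by_contra hcon
  push Not at hcon
  obtain ⟨z, hz⟩ := hne
  obtain ⟨ε, hε, hball⟩ := Metric.isOpen_iff.mp hW z hz
  set z' : ℝ × ℝ³ := (z.1 + ε / 2, z.2) with hz'
  have hz'mem : z' ∈ W₁ := hball (by
    rw [Metric.mem_ball, Prod.dist_eq, hz']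
    simp only [dist_self]
    rw [max_eq_left dist_nonneg, Real.dist_eq, add_sub_cancel_left, abs_of_pos (half_pos hε)]
    exact half_lt_self hε)
  have key : ∀ w ∈ W₁, μ = -(s ^ 2 * exp (-6 * w.1)) := fun w hw => by
    have h := hcon w hw 1 (by decide)
    rw [shear_strainedField s a b c w.1 w.2 1 (by decide), fderiv_strainedField_single] at h
    have hD : jac s a b c w.1 w.2 1 2 ≠ 0 := by
      simp [jac, hc, (G_pos s w.1).ne', α_ne_zero, (E₃_pos s w.1 w.2).ne']
    have := mul_right_cancel₀ hD h
    rw [← this, sq_σ_div_sq_α]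
  have h1 := key z hz
  have h2 := key z' hz'mem
  rw [h1, hz'] at h2
  have h3 : exp (-6 * z.1) = exp (-6 * (z.1 + ε / 2)) := by
    have := neg_injective h2
    exact mul_left_cancel₀ (pow_ne_zero 2 hs) this
  have h4 := exp_injective h3
  linarith

end Summit.NavierStokesRegularity.NavierStokesRegularity.Theorems.PoloidalWindowRigidity.Negative.StrainedLayers
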